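import Literature.Algebra.GroupRings.SubgroupProjection
import Literature.Algebra.GroupRings.NilLeftIdealsPrimeCharacteristic
import Literature.Algebra.GroupRings.NormalSubgroupSumRadical
import Mathlib.Algebra.CharP.Two
import Mathlib.GroupTheory.Index
import Mathlib.RingTheory.Artinian.Module
import Mathlib.RingTheory.Jacobson.Semiprimary
import HarnessLib

/-!
# Lam §6 Exercise 6.13 (Passman): group rings of `A ⋊ ⟨x⟩`, `A` an abelian `2'`-group inverted by `x`, in characteristic `2`

[cite: Lam2001FirstCourse, §6 Exercise 6.13, p. 98]

Lam, *A First Course in Noncommutative Rings*, Exercises for §6 (p. 98; p0110 of the held scan):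

**Ex. 6.13.** (Passman) Assume `char k = 2`. Let `A` be an abelian `2'`-group and let `G` be the semidirect product of `A` and a cyclic
group `⟨x⟩` of order `2`, where `x` acts on `A` by `a ↦ a⁻¹`.
(1) If `|A| < ∞`, show that `rad kG = k · Σ_{g∈G} g`, and `(rad kG)² = 0`.
(2) If `A` is infinite, show that `kG` has no nonzero nil ideals.
(Hint. Any element in `kG` can be expressed in the form `α + βx`, `α, β ∈ kA`. …)

## Formalisation

`G` is any group with a subgroup `A` (commutative: `IsMulCommutative A`) and an element `x` with `x² = 1`, `x ∉ A`, `x a x⁻¹ = a⁻¹` for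
`a ∈ A`, and `G = A ∪ Ax` (`∀ g, g ∈ A ∨ gx ∈ A`) — i.e. `G = A ⋊ ⟨x⟩` with the inverting action; «`2'`-group» is «no element of order `2`».
`kA ⊆ kG` is `ι = mapDomain A.subtype` with the projection `π = subgroupProj A` of the tree's `SubgroupProjection`.  Instead of the
hint's `*`-computation we use the commutator identity `aγ − γa⁻¹ = ι((a − a⁻¹)·π(γ))` (§1), valid for every `γ ∈ kG`: for `γ` in a nil ideal
the right side is a nilpotent element of the commutative reduced ring `kA` ((6.13) in the tree: `char k = 2`, `A` a `2'`-group, `k`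
reduced), hence `0`; so `π(γ)` is invariant under all translations `g ↦ a²g` (§2), which forces `π(γ) = 0` when `A` is infinite (squaring is
injective on a `2'`-group) and `π(γ)` constant when `A` is finite (squaring is then onto).  §3: part (2).  §4: part (1) for a field `k`
of characteristic `2`: `rad kG = kG·τ = k·τ`, `τ = Σ_{g∈G} g` (the tree's `subgroupSum` of `⊤`), and `(rad kG)² = 0`.

## References

* [Lam2001FirstCourse] T. Y. Lam, *A First Course in Noncommutative Rings*, 2nd ed., Graduate Texts in Mathematics 131, Springer, 2001,
  §6 Exercise 6.13, p. 98 (held scan `book:lamnd-first-course-noncommutative-rings`, p0110); Prop. (6.13), pp. 88–89.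
-/

universe u w

namespace Literature.Algebra.GroupRings

open MonoidAlgebra

/-! ## §1 The identity `aγ − γa⁻¹ = ι((a − a⁻¹)π(γ))` and the decomposition `γ = ι(πγ) + ι(π(γx))x` -/

section Identities

variable {k : Type u} [CommRing k] {G : Type w} [Group G] (A : Subgroup G) [IsMulCommutative A] {x : G}

/-- In `G = A ∪ Ax` with `x a x⁻¹ = a⁻¹` (`a ∈ A`, `A` abelian, `x² = 1`): `a g = g a⁻¹` for `g ∉ A`.
[cite: Lam2001FirstCourse, §6 Exercise 6.13 (Hint: «`xα = α*x`»)] -/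
theorem mul_eq_mul_inv_of_not_mem (hx2 : x * x = 1) (hxA : ∀ a ∈ A, x * a * x⁻¹ = a⁻¹) (hcov : ∀ g : G, g ∈ A ∨ g * x ∈ A)
    {a g : G} (ha : a ∈ A) (hg : g ∉ A) : a * g = g * a⁻¹ := by
  obtain ⟨b, hb, rfl⟩ : ∃ b ∈ A, g = b * x := ⟨g * x, (hcov g).resolve_left hg, by rw [mul_assoc, hx2, mul_one]⟩
  -- `x a⁻¹ = a x`
  have h1 : x * a⁻¹ = a * x := by
    have h := hxA a⁻¹ (A.inv_mem ha)
    rw [inv_inv] at h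
    conv_rhs => rw [← h, inv_mul_cancel_right]
  rw [mul_assoc b x a⁻¹, h1, ← mul_assoc b a x, ← mul_assoc a b x, setLike_mul_comm ha hb]

/-- **`aγ − γa⁻¹ = ι((a − a⁻¹)·π_A(γ))` for every `γ ∈ kG`, `a ∈ A`** (check on monomials: `g ∈ A` commutes with `a`; for `g ∉ A`,
`ag = ga⁻¹`). [cite: Lam2001FirstCourse, §6 Exercise 6.13 (Hint)] -/
theorem single_mul_sub_mul_single_inv (hx2 : x * x = 1) (hxA : ∀ a ∈ A, x * a * x⁻¹ = a⁻¹) (hcov : ∀ g : G, g ∈ A ∨ g * x ∈ A)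
    {a : G} (ha : a ∈ A) (γ : MonoidAlgebra k G) :
    single a (1 : k) * γ - γ * single a⁻¹ 1 =
      mapDomainRingHom k A.subtype ((single ⟨a, ha⟩ (1 : k) - single ⟨a⁻¹, A.inv_mem ha⟩ 1) * subgroupProj A γ) := by
  induction γ using MonoidAlgebra.induction_linear with
  | zero => rw [mul_zero, zero_mul, sub_self, map_zero, mul_zero, map_zero]
  | add γ δ hγ hδ => rw [mul_add, add_mul, add_sub_add_comm, hγ, hδ, map_add, mul_add, map_add]
  | single g r =>
    have hι : ∀ (d : A) (r : k), mapDomainRingHom k A.subtype (single d r) = single (d : G) r := fun d r ↦ by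
      change mapDomain A.subtype (single d r) = _
      exact mapDomain_single
    by_cases hg : g ∈ A
    · rw [subgroupProj_single_of_mem A hg, sub_mul, map_sub]
      simp only [single_mul_single, one_mul, mul_one, hι]
      change single (a * g) r - single (g * a⁻¹) r = single (a * g) r - single (a⁻¹ * g) r
      rw [setLike_mul_comm hg (A.inv_mem ha)]
    · rw [subgroupProj_single_of_not_mem A hg, mul_zero, map_zero, single_mul_single, single_mul_single, one_mul, mul_one,
        mul_eq_mul_inv_of_not_mem A hx2 hxA hcov ha hg, sub_self]

omit [IsMulCommutative A] in
/-- Reconstruction from the two projections: `π_A(γ) = 0` and `π_A(γx) = 0` force `γ = 0` (`G = A ∪ Ax`).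
[cite: Lam2001FirstCourse, §6 Exercise 6.13 (Hint: «`α + βx`, `α, β ∈ kA`»)] -/
theorem eq_zero_of_subgroupProj_eq_zero (hcov : ∀ g : G, g ∈ A ∨ g * x ∈ A) {γ : MonoidAlgebra k G}
    (h1 : subgroupProj A γ = 0) (h2 : subgroupProj A (γ * single x 1) = 0) : γ = 0 := by
  refine coeff_inj.1 (Finsupp.ext fun g ↦ ?_)
  rw [coeff_zero, Finsupp.zero_apply]
  by_cases hg : g ∈ A
  · have h := congrArg (fun y : MonoidAlgebra k A ↦ y.coeff ⟨g, hg⟩) h1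
    simpa only [coeff_subgroupProj, coeff_zero, Finsupp.zero_apply] using h
  · have hb : g * x ∈ A := (hcov g).resolve_left hg
    have h := congrArg (fun y : MonoidAlgebra k A ↦ y.coeff ⟨g * x, hb⟩) h2
    simp only [coeff_subgroupProj, coeff_zero, Finsupp.zero_apply, coeff_mul_single_apply, mul_one] at h
    rwa [mul_inv_cancel_right] at h

omit [IsMulCommutative A] in
/-- **«Any element in `kG` can be expressed in the form `α + βx`, `α, β ∈ kA`»**: `γ = ι(π_A γ) + ι(π_A(γx))·x` (`x ∉ A`, `x² = 1`).
[cite: Lam2001FirstCourse, §6 Exercise 6.13 (Hint)] -/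
theorem eq_mapDomain_add_mapDomain_mul_single (hx2 : x * x = 1) (hx : x ∉ A) (hcov : ∀ g : G, g ∈ A ∨ g * x ∈ A) (γ : MonoidAlgebra k G) :
    γ = mapDomain A.subtype (subgroupProj A γ) + mapDomain A.subtype (subgroupProj A (γ * single x 1)) * single x 1 := by
  have hX : (single x (1 : k) : MonoidAlgebra k G) * single x 1 = 1 := by rw [single_mul_single, hx2, mul_one, one_def]
  have hπX : subgroupProj A (single x (1 : k)) = 0 := subgroupProj_single_of_not_mem A hx 1
  rw [← sub_eq_zero]
  refine eq_zero_of_subgroupProj_eq_zero A hcov ?_ ?_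
  · rw [map_sub, map_add, subgroupProj_mapDomain, subgroupProj_mapDomain_mul, hπX, mul_zero, add_zero, sub_self]
  · rw [sub_mul, add_mul, mul_assoc, hX, mul_one, map_sub, map_add, subgroupProj_mapDomain_mul, hπX, mul_zero, zero_add,
      subgroupProj_mapDomain, sub_self]

end Identities

/-! ## §2 `kA` for an abelian `2'`-group `A` in characteristic `2`: reducedness; translation-invariant elements -/

section Abelian

variable {k : Type u} [CommRing k] {A : Type w} [CommGroup A]

/-- `char k = 2`, `k` reduced, `A` an abelian `2'`-group ⟹ `kA` is reduced ((6.13): in the commutative ring `kA` every nilpotent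
element has all translates nilpotent, hence is `0`). [cite: Lam2001FirstCourse, §6 Prop. (6.13); Exercise 6.13] -/
theorem isReduced_monoidAlgebra_of_orderOf_ne_two [IsReduced k] [CharP k 2] (hA : ∀ a : A, orderOf a ≠ 2) :
    IsReduced (MonoidAlgebra k A) :=
  ⟨fun _ hβ ↦ eq_zero_of_forall_isNilpotent_single_mul 2 hA fun _ ↦ (Commute.all _ _).isNilpotent_mul_left hβ⟩

/-- Squaring is injective on an abelian `2'`-group. [cite: Lam2001FirstCourse, §6 Exercise 6.13] -/
theorem mul_self_injective_of_orderOf_ne_two (hA : ∀ a : A, orderOf a ≠ 2) : Function.Injective fun a : A ↦ a * a := by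
  intro a b hab
  dsimp only at hab
  have h1 : (a * b⁻¹) ^ 2 = 1 := by
    rw [pow_two, mul_mul_mul_comm, hab, mul_mul_mul_comm, mul_inv_cancel, mul_one]
  have h2 : orderOf (a * b⁻¹) ∣ 2 := orderOf_dvd_of_pow_eq_one h1
  rcases (Nat.dvd_prime Nat.prime_two).1 h2 with h | h
  · exact mul_inv_eq_one.1 (orderOf_eq_one_iff.1 h)
  · exact absurd h (hA _)

/-- If `(a − a⁻¹)α = 0` for all `a ∈ A` then `α` is invariant under `g ↦ a²g`: `α_g = α_{a²g}`. [cite: Lam2001FirstCourse, §6 Exercise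
6.13] -/
theorem coeff_eq_coeff_mul_self_mul {α : MonoidAlgebra k A} (h : ∀ a : A, (single a (1 : k) - single a⁻¹ 1) * α = 0) (a g : A) :
    α.coeff g = α.coeff (a * a * g) := by
  have h0 : single a (1 : k) * α = single a⁻¹ 1 * α := sub_eq_zero.1 (by rw [← sub_mul]; exact h a)
  have h1 := congrArg (fun y : MonoidAlgebra k A ↦ y.coeff (a * g)) h0
  simp only [coeff_single_mul_apply, one_mul, inv_inv, inv_mul_cancel_left] at h1
  rw [h1, mul_assoc]

/-- **`A` infinite**: `(a − a⁻¹)α = 0` for all `a ∈ A` forces `α = 0` (the support of `α ≠ 0` would contain the infinite set `{a²g₀}`).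
[cite: Lam2001FirstCourse, §6 Exercise 6.13 (2)] -/
theorem eq_zero_of_forall_sub_inv_mul_eq_zero [Infinite A] (hA : ∀ a : A, orderOf a ≠ 2) {α : MonoidAlgebra k A}
    (h : ∀ a : A, (single a (1 : k) - single a⁻¹ 1) * α = 0) : α = 0 := by
  by_contra hα
  obtain ⟨g₀, hg₀⟩ : ∃ g₀, α.coeff g₀ ≠ 0 := by
    by_contra h0
    exact hα (coeff_inj.1 (Finsupp.ext fun g ↦ not_not.1 (not_exists.1 h0 g)))
  haveI : Finite (α.coeff.support : Set A) := α.coeff.support.finite_toSet.to_subtype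
  have hf : Function.Injective fun a : A ↦ (⟨a * a * g₀, Finset.mem_coe.2 (Finsupp.mem_support_iff.2
      (by rw [← coeff_eq_coeff_mul_self_mul h a g₀]; exact hg₀))⟩ : (α.coeff.support : Set A)) := fun a b hab ↦
    mul_self_injective_of_orderOf_ne_two hA (mul_right_cancel (Subtype.ext_iff.1 hab))
  haveI := Finite.of_injective _ hf
  exact not_finite A

/-- **`A` finite**: `(a − a⁻¹)α = 0` for all `a ∈ A` forces `α` to have all coefficients equal (squaring is then onto).
[cite: Lam2001FirstCourse, §6 Exercise 6.13 (1)] -/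
theorem coeff_eq_coeff_one_of_forall_sub_inv_mul_eq_zero [Finite A] (hA : ∀ a : A, orderOf a ≠ 2) {α : MonoidAlgebra k A}
    (h : ∀ a : A, (single a (1 : k) - single a⁻¹ 1) * α = 0) (g : A) : α.coeff g = α.coeff 1 := by
  obtain ⟨a, ha⟩ := Finite.surjective_of_injective (mul_self_injective_of_orderOf_ne_two hA) g⁻¹
  have h1 := coeff_eq_coeff_mul_self_mul h a g
  rw [show a * a = g⁻¹ from ha, inv_mul_cancel] at h1
  exact h1

end Abelian

/-! ## §3 Exercise 6.13 (2): `A` infinite ⟹ `kG` has no nonzero nil ideals -/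

section Main

variable {k : Type u} [CommRing k] {G : Type w} [Group G] (A : Subgroup G) [IsMulCommutative A] {x : G}

omit [IsMulCommutative A] in
/-- `2'` passes to the subgroup type. [cite: Lam2001FirstCourse, §6 Exercise 6.13] -/
theorem orderOf_coe_ne_two (hA2 : ∀ a ∈ A, orderOf a ≠ 2) (a : A) : orderOf a ≠ 2 := by
  rw [← Subgroup.orderOf_coe]
  exact hA2 a a.2

/-- For `γ` in a nil two-sided ideal `I` of `kG`: `(a − a⁻¹)·π_A(γ) = 0` in `kA` for every `a ∈ A` (it is nilpotent — its image
`aγ − γa⁻¹` lies in `I` — and `kA` is reduced). [cite: Lam2001FirstCourse, §6 Exercise 6.13 (Hint); Prop. (6.13)] -/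
theorem sub_inv_mul_subgroupProj_eq_zero [IsReduced k] [CharP k 2] (hA2 : ∀ a ∈ A, orderOf a ≠ 2) (hx2 : x * x = 1)
    (hxA : ∀ a ∈ A, x * a * x⁻¹ = a⁻¹) (hcov : ∀ g : G, g ∈ A ∨ g * x ∈ A) (I : Ideal (MonoidAlgebra k G)) [I.IsTwoSided]
    (hI : ∀ γ ∈ I, IsNilpotent γ) {γ : MonoidAlgebra k G} (hγ : γ ∈ I) (a : A) :
    (single a (1 : k) - single a⁻¹ 1) * subgroupProj A γ = 0 := by
  letI : CommGroup A := { mul_comm := mul_comm' }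
  haveI : IsReduced (MonoidAlgebra k A) := isReduced_monoidAlgebra_of_orderOf_ne_two (orderOf_coe_ne_two A hA2)
  have hmem : single (a : G) (1 : k) * γ - γ * single (a : G)⁻¹ 1 ∈ I := I.sub_mem (I.mul_mem_left _ hγ) (I.mul_mem_right _ hγ)
  obtain ⟨n, hn⟩ := hI _ hmem
  rw [single_mul_sub_mul_single_inv A hx2 hxA hcov a.2 γ, ← map_pow, map_eq_zero_iff _ (mapDomain_injective Subtype.val_injective)] at hn
  have h0 := IsReduced.eq_zero _ ⟨n, hn⟩
  have ha : (⟨(a : G)⁻¹, A.inv_mem a.2⟩ : A) = a⁻¹ := rfl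
  rwa [Subtype.coe_eta, ha] at h0

/-- **LAM Exercise 6.13 (2) (Passman): `char k = 2` (`k` a reduced commutative ring), `G = A ⋊ ⟨x⟩` with `A` an INFINITE abelian
`2'`-group inverted by the involution `x` ⟹ `kG` has no nonzero nil ideals** (although `x ∈ G` has order `2`).
[cite: Lam2001FirstCourse, §6 Exercise 6.13 (2)] -/
theorem eq_bot_of_nil_of_infinite [IsReduced k] [CharP k 2] (hA2 : ∀ a ∈ A, orderOf a ≠ 2) (hinf : (A : Set G).Infinite)
    (hx2 : x * x = 1) (hxA : ∀ a ∈ A, x * a * x⁻¹ = a⁻¹) (hcov : ∀ g : G, g ∈ A ∨ g * x ∈ A)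
    (I : Ideal (MonoidAlgebra k G)) [I.IsTwoSided] (hI : ∀ γ ∈ I, IsNilpotent γ) : I = ⊥ := by
  letI : CommGroup A := { mul_comm := mul_comm' }
  haveI : Infinite A := hinf.to_subtype
  refine eq_bot_iff.2 fun γ hγ ↦ ?_
  rw [Submodule.mem_bot]
  refine eq_zero_of_subgroupProj_eq_zero A hcov ?_ ?_
  · exact eq_zero_of_forall_sub_inv_mul_eq_zero (orderOf_coe_ne_two A hA2)
      (sub_inv_mul_subgroupProj_eq_zero A hA2 hx2 hxA hcov I hI hγ)
  · exact eq_zero_of_forall_sub_inv_mul_eq_zero (orderOf_coe_ne_two A hA2)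
      (sub_inv_mul_subgroupProj_eq_zero A hA2 hx2 hxA hcov I hI (I.mul_mem_right _ hγ))

/-! ## §4 Exercise 6.13 (1): `A` finite, `k` a field ⟹ `rad kG = k·Σ_{g∈G} g` and `(rad kG)² = 0` -/

omit [IsMulCommutative A] in
/-- `[G : A] = 2`. [cite: Lam2001FirstCourse, §6 Exercise 6.13] -/
theorem index_eq_two (hx : x ∉ A) (hcov : ∀ g : G, g ∈ A ∨ g * x ∈ A) : A.index = 2 := by
  refine Subgroup.index_eq_two_iff.2 ⟨x, fun b ↦ ?_⟩
  rcases hcov b with hb | hb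
  · exact Or.inr ⟨hb, fun hbx ↦ hx (by simpa using A.mul_mem (A.inv_mem hb) hbx)⟩
  · exact Or.inl ⟨hb, fun hb' ↦ hx (by simpa using A.mul_mem (A.inv_mem hb') hb)⟩

omit [IsMulCommutative A] in
/-- `|G| = 2|A| = 0` in `k` (characteristic `2`). [cite: Lam2001FirstCourse, §6 Exercise 6.13 (1)] -/
theorem natCard_top_eq_zero [CharP k 2] [Finite G] (hx : x ∉ A) (hcov : ∀ g : G, g ∈ A ∨ g * x ∈ A) :
    (Nat.card (⊤ : Subgroup G) : k) = 0 := by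
  rw [Subgroup.card_top, ← A.index_mul_card, index_eq_two A hx hcov, Nat.cast_mul, Nat.cast_two, CharTwo.two_eq_zero, zero_mul]

variable [Fintype G]

omit [IsMulCommutative A] in
/-- `τ = Σ_{g∈G} g` is the tree's `subgroupSum` of `⊤`. [cite: Lam2001FirstCourse, §6 p. 90] -/
theorem sum_top_eq_sum_univ [Fintype (⊤ : Subgroup G)] :
    (∑ g : (⊤ : Subgroup G), (single (g : G) (1 : k) : MonoidAlgebra k G)) = ∑ g : G, (single g (1 : k) : MonoidAlgebra k G) :=
  Fintype.sum_equiv Subgroup.topEquiv.toEquiv _ _ fun _ ↦ rfl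

omit [IsMulCommutative A] in
/-- `τ = Σ_{g∈G} g ∈ rad kG` (`|G| = 2|A| = 0` in `k`; `τ` central with `τ² = |G|τ = 0`). [cite: Lam2001FirstCourse, §6 Exercise 6.13
(1); p. 90] -/
theorem sum_univ_mem_jacobson [CharP k 2] (hx : x ∉ A) (hcov : ∀ g : G, g ∈ A ∨ g * x ∈ A) :
    (∑ g : G, (single g (1 : k) : MonoidAlgebra k G)) ∈ Ring.jacobson (MonoidAlgebra k G) := by
  classical
  rw [← sum_top_eq_sum_univ]
  exact subgroupSum_mem_jacobson ⊤ (natCard_top_eq_zero A hx hcov)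

omit [IsMulCommutative A] in
/-- `(aτ)(bτ) = 0` for `τ = Σ_{g∈G} g`. [cite: Lam2001FirstCourse, §6 Exercise 6.13 (1); p. 90] -/
theorem mul_sum_univ_mul_mul_sum_univ [CharP k 2] (hx : x ∉ A) (hcov : ∀ g : G, g ∈ A ∨ g * x ∈ A) (a b : MonoidAlgebra k G) :
    (a * ∑ g : G, (single g (1 : k) : MonoidAlgebra k G)) * (b * ∑ g : G, (single g (1 : k) : MonoidAlgebra k G)) = 0 := by
  classical
  rw [← sum_top_eq_sum_univ]
  exact mul_subgroupSum_mul_mul_subgroupSum ⊤ (natCard_top_eq_zero A hx hcov) a b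

omit [Group G] [IsMulCommutative A] in
/-- `τ` has all coefficients `1`. [cite: Lam2001FirstCourse, §6 Exercise 6.13 (1)] -/
theorem coeff_sum_univ (g : G) : (∑ h : G, (single h (1 : k) : MonoidAlgebra k G)).coeff g = 1 := by
  classical
  rw [coeff_sum, Finsupp.finsetSum_apply, Finset.sum_eq_single g]
  · rw [coeff_single, Finsupp.single_eq_same]
  · intro h _ hne
    rw [coeff_single, Finsupp.single_apply, if_neg hne]
  · exact fun hn ↦ absurd (Finset.mem_univ _) hn

/-- For `γ ∈ rad kG` (`A` finite, `k` a field of characteristic `2`): `γ` has the same coefficient at every `a ∈ A`.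
[cite: Lam2001FirstCourse, §6 Exercise 6.13 (1)] -/
theorem coeff_eq_coeff_one_of_mem_jacobson {k : Type u} [Field k] [CharP k 2] (hA2 : ∀ a ∈ A, orderOf a ≠ 2) (hx2 : x * x = 1)
    (hxA : ∀ a ∈ A, x * a * x⁻¹ = a⁻¹) (hcov : ∀ g : G, g ∈ A ∨ g * x ∈ A) {γ : MonoidAlgebra k G}
    (hγ : γ ∈ Ring.jacobson (MonoidAlgebra k G)) {a : G} (ha : a ∈ A) : γ.coeff a = γ.coeff 1 := by
  letI : CommGroup A := { mul_comm := mul_comm' }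
  haveI : Module.Finite k (MonoidAlgebra k G) := Module.Finite.of_basis (MonoidAlgebra.basis G k)
  haveI : IsArtinianRing (MonoidAlgebra k G) := IsArtinianRing.of_finite k _
  have hnil : ∀ δ ∈ Ring.jacobson (MonoidAlgebra k G), IsNilpotent δ := fun δ hδ ↦ by
    obtain ⟨n, hn⟩ := (IsSemiprimaryRing.isNilpotent : IsNilpotent (Ring.jacobson (MonoidAlgebra k G)))
    exact ⟨n, by simpa [hn] using Ideal.pow_mem_pow hδ n⟩
  have h := coeff_eq_coeff_one_of_forall_sub_inv_mul_eq_zero (orderOf_coe_ne_two A hA2)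
    (sub_inv_mul_subgroupProj_eq_zero A hA2 hx2 hxA hcov _ hnil hγ) ⟨a, ha⟩
  rwa [coeff_subgroupProj, coeff_subgroupProj] at h

/-- **LAM Exercise 6.13 (1), the key step: for `γ ∈ rad kG` (`k` a field of characteristic `2`, `A` finite), `γ = γ₁·τ` with
`τ = Σ_{g∈G} g`** — `γ − γ₁τ ∈ rad` vanishes on `A`, so `(γ − γ₁τ)x` lies in `ι(kA) ∩ rad kG`, a nilpotent element of the reduced ring
`kA`, hence `0`. [cite: Lam2001FirstCourse, §6 Exercise 6.13 (1)] -/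
theorem eq_single_mul_sum_of_mem_jacobson {k : Type u} [Field k] [CharP k 2] (hA2 : ∀ a ∈ A, orderOf a ≠ 2) (hx2 : x * x = 1)
    (hx : x ∉ A) (hxA : ∀ a ∈ A, x * a * x⁻¹ = a⁻¹) (hcov : ∀ g : G, g ∈ A ∨ g * x ∈ A) {γ : MonoidAlgebra k G}
    (hγ : γ ∈ Ring.jacobson (MonoidAlgebra k G)) :
    γ = single 1 (γ.coeff 1) * ∑ g : G, (single g (1 : k) : MonoidAlgebra k G) := by
  classical
  letI : CommGroup A := { mul_comm := mul_comm' }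
  set τ : MonoidAlgebra k G := ∑ g : G, (single g (1 : k) : MonoidAlgebra k G) with hτ
  have hτmem : τ ∈ Ring.jacobson (MonoidAlgebra k G) := sum_univ_mem_jacobson A hx hcov
  haveI : Module.Finite k (MonoidAlgebra k G) := Module.Finite.of_basis (MonoidAlgebra.basis G k)
  haveI : IsArtinianRing (MonoidAlgebra k G) := IsArtinianRing.of_finite k _
  haveI : IsReduced (MonoidAlgebra k A) := isReduced_monoidAlgebra_of_orderOf_ne_two (orderOf_coe_ne_two A hA2)
  have hnil : ∀ δ ∈ Ring.jacobson (MonoidAlgebra k G), IsNilpotent δ := fun δ hδ ↦ by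
    obtain ⟨n, hn⟩ := (IsSemiprimaryRing.isNilpotent : IsNilpotent (Ring.jacobson (MonoidAlgebra k G)))
    exact ⟨n, by simpa [hn] using Ideal.pow_mem_pow hδ n⟩
  -- `γ' = γ − γ₁τ ∈ rad` vanishes on `A`
  set c : k := γ.coeff 1 with hc
  set γ' : MonoidAlgebra k G := γ - single 1 c * τ with hγ'
  have hγ'mem : γ' ∈ Ring.jacobson (MonoidAlgebra k G) := sub_mem hγ (Ideal.mul_mem_left _ _ hτmem)
  have hA0 : ∀ a ∈ A, γ'.coeff a = 0 := fun a ha ↦ by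
    rw [hγ', coeff_sub, Finsupp.sub_apply, coeff_single_mul_apply, inv_one, one_mul, hτ, coeff_sum_univ, mul_one,
      coeff_eq_coeff_one_of_mem_jacobson A hA2 hx2 hxA hcov hγ ha, sub_self]
  -- `δ = γ'x ∈ rad` is supported in `A`
  set δ : MonoidAlgebra k G := γ' * single x 1 with hδ
  have hδmem : δ ∈ Ring.jacobson (MonoidAlgebra k G) := Ideal.mul_mem_right _ _ hγ'mem
  have hxinv : x⁻¹ = x := inv_eq_of_mul_eq_one_right hx2
  have hδsupp : ∀ g ∈ δ.coeff.support, g ∈ A := fun g hg ↦ by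
    by_contra hgA
    have hb : g * x⁻¹ ∈ A := by rw [hxinv]; exact (hcov g).resolve_left hgA
    rw [Finsupp.mem_support_iff, hδ, coeff_mul_single_apply, mul_one] at hg
    exact hg (hA0 _ hb)
  have hδeq : mapDomain A.subtype (subgroupProj A δ) = δ := mapDomain_subgroupProj_of_support_subset A hδsupp
  -- `π δ` is a nilpotent element of the reduced ring `kA`
  obtain ⟨n, hn⟩ := hnil δ hδmem
  have hπn : subgroupProj A δ ^ n = 0 := by
    apply mapDomain_injective (R := k) Subtype.val_injective
    change mapDomainRingHom k A.subtype (subgroupProj A δ ^ n) = mapDomainRingHom k A.subtype 0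
    rw [map_pow, map_zero]
    change mapDomain A.subtype (subgroupProj A δ) ^ n = 0
    rw [hδeq, hn]
  have hπ0 : subgroupProj A δ = 0 := IsReduced.eq_zero _ ⟨n, hπn⟩
  have hδ0 : δ = 0 := by
    rw [← hδeq, hπ0]
    exact map_zero (mapDomainRingHom k A.subtype)
  -- `γ' = δx = 0`
  have hγ'0 : γ' = 0 := by
    have h1 : γ' = δ * single x 1 := by rw [hδ, mul_assoc, single_mul_single, hx2, mul_one, ← one_def, mul_one]
    rw [h1, hδ0, zero_mul]
  rw [hγ', sub_eq_zero] at hγ'0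
  exact hγ'0

/-- **LAM Exercise 6.13 (1) (Passman): `char k = 2` (`k` a field), `G = A ⋊ ⟨x⟩` with `A` a FINITE abelian `2'`-group inverted by
`x` ⟹ `rad kG = kG·τ = k·τ`, `τ = Σ_{g∈G} g`** (`⊇`: `τ` is central with `τ² = |G|τ = 0`). [cite: Lam2001FirstCourse, §6 Exercise
6.13 (1)] -/
theorem jacobson_eq_span_sum {k : Type u} [Field k] [CharP k 2] (hA2 : ∀ a ∈ A, orderOf a ≠ 2) (hx2 : x * x = 1) (hx : x ∉ A)
    (hxA : ∀ a ∈ A, x * a * x⁻¹ = a⁻¹) (hcov : ∀ g : G, g ∈ A ∨ g * x ∈ A) :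
    Ring.jacobson (MonoidAlgebra k G) = Ideal.span {∑ g : G, (single g (1 : k) : MonoidAlgebra k G)} := by
  refine le_antisymm (fun γ hγ ↦ ?_) ((Ideal.span_singleton_le_iff_mem _).2 (sum_univ_mem_jacobson A hx hcov))
  rw [eq_single_mul_sum_of_mem_jacobson A hA2 hx2 hx hxA hcov hγ]
  exact Ideal.mul_mem_left _ _ (Ideal.mem_span_singleton_self _)

/-- **… `rad kG = k·τ` as a set: every element of `rad kG` is a scalar multiple of `τ = Σ_{g∈G} g`.** [cite: Lam2001FirstCourse, §6
Exercise 6.13 (1)] -/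
theorem exists_eq_smul_sum_of_mem_jacobson {k : Type u} [Field k] [CharP k 2] (hA2 : ∀ a ∈ A, orderOf a ≠ 2) (hx2 : x * x = 1)
    (hx : x ∉ A) (hxA : ∀ a ∈ A, x * a * x⁻¹ = a⁻¹) (hcov : ∀ g : G, g ∈ A ∨ g * x ∈ A) {γ : MonoidAlgebra k G}
    (hγ : γ ∈ Ring.jacobson (MonoidAlgebra k G)) :
    ∃ c : k, γ = c • ∑ g : G, (single g (1 : k) : MonoidAlgebra k G) :=
  ⟨γ.coeff 1, by
    conv_lhs => rw [eq_single_mul_sum_of_mem_jacobson A hA2 hx2 hx hxA hcov hγ]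
    rw [show (single 1 (γ.coeff 1) : MonoidAlgebra k G) = γ.coeff 1 • (1 : MonoidAlgebra k G) by
      rw [one_def, smul_single, smul_eq_mul, mul_one], smul_mul_assoc, one_mul]⟩

/-- **LAM Exercise 6.13 (1) (Passman): `(rad kG)² = 0`.** [cite: Lam2001FirstCourse, §6 Exercise 6.13 (1)] -/
theorem jacobson_mul_jacobson_eq_bot {k : Type u} [Field k] [CharP k 2] (hA2 : ∀ a ∈ A, orderOf a ≠ 2) (hx2 : x * x = 1)
    (hx : x ∉ A) (hxA : ∀ a ∈ A, x * a * x⁻¹ = a⁻¹) (hcov : ∀ g : G, g ∈ A ∨ g * x ∈ A) :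
    Ring.jacobson (MonoidAlgebra k G) * Ring.jacobson (MonoidAlgebra k G) = ⊥ := by
  rw [jacobson_eq_span_sum A hA2 hx2 hx hxA hcov]
  refine eq_bot_iff.2 (Submodule.mul_le.2 fun m hm n hn ↦ ?_)
  obtain ⟨a, rfl⟩ := Ideal.mem_span_singleton'.1 hm
  obtain ⟨b, rfl⟩ := Ideal.mem_span_singleton'.1 hn
  rw [Submodule.mem_bot]
  exact mul_sum_univ_mul_mul_sum_univ A hx hcov a b

end Main

end Literature.Algebra.GroupRings
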